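import Mathlib
import HarnessLib
import Summits.HubbardSuperconductivity.HubbardSuperconductivity.Theses.KLProgramme
import Summits.HubbardSuperconductivity.HubbardSuperconductivity.Theorems.KLProgrammeKLRegimeVolumeLimitExDefs
import Summits.HubbardSuperconductivity.HubbardSuperconductivity.Theorems.KLProgrammeKLRegimeSplitSlotsV17F2

/-!
# Route `KLProgramme` — crux K3 gen-8 (7-flow, cure 1), child `KLRegimeTwoPointAssemblyV17F2 := TwoPointAssemblyP3 klPredsV17F2 FinalTwoLegVolLimitEx klWindowC`, CLOSED
# AT BIRTH by the generic `twoPointAssemblyP3_ex` (…VolumeLimitExDefs: with the ∃-threshold final slot the assembly IS the slot's content).  Proof only;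
# nothing here asserts superconductivity.
-/

noncomputable section

namespace Summit.HubbardSuperconductivity.HubbardSuperconductivity.Theorems.TwoPointAssembly

set_option linter.dupNamespace false -- summit = problem name (single-conjunct summit), D-0017

/-- **Gen-8 (7-flow, cure 1) child TwoPointAssembly of crux K3, CLOSED**: the route decl `…Theses.KLProgramme.KLRegimeTwoPointAssemblyV17F2` by name. -/
theorem KLRegimeTwoPointAssemblyV17F2_of :
    Summit.HubbardSuperconductivity.HubbardSuperconductivity.Theses.KLProgramme.KLRegimeTwoPointAssemblyV17F2 :=
  KLRegimeSplit.twoPointAssemblyP3_ex KLRegimeSplit.klPredsV17F2 KLRegimeSplit.klWindowC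

end Summit.HubbardSuperconductivity.HubbardSuperconductivity.Theorems.TwoPointAssembly

end
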